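import Literature.AlgebraicGeometry.Hu2025.Statements.S04ModelV.R103aModelR
import Mathlib.Algebra.MvPolynomial.CommRing
import HarnessLib

/-!
# Hu 2025 §4.1–§4.2.1 — toolkit on the row-103 carrier (`φ ∘ (R_0 ⊂ R) = id`, `φ(x_t) = x̄_t`, `R_[Υ] = R`, block
# weights); Lem. 4.5 ‹chunk Lem. 4.4› / (4.8) DISCHARGED AS TYPED (`Lem4_5_holds`); `φ` is a monomial map and the
# claim C22L5 «it suffices to consider binomials» DISCHARGED AS TYPED (`C22L5_holds`); file
# `Proofs/S04ModelV/Lem45.lean`, typer of record res-type-042 (row 103)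

**HONEST FRAMING (D-0012/D-0089).** Theorems about OUR typed rendering `Statements/S04ModelV/R103aModelR.lean`
(pre-draft res-type-024, filed by res-type-042). The preprint [Hu2025] (arXiv:2507.21400v1) stays «under review»;
nothing of it is asserted; AI proof is weaker than expert review; nothing here is progress on resolution of
singularities. Locators: chunks p0021 l.107–140, p0022 l.10–27; PDF p.46 L005–L019, p.47 L017–L025
(`lit/res-lit-6/hu25/text/`).

* §1 toolkit (consumed by `DescentKernel.lean`): `toModel_img`, `varphi_toModel` («`φ_[k]|_{R_0} = Id`»),
  `varphi_rhoVar` («`x_(u_s,v_s) → x_{u_s}x_{v_s}`»), `RSub_univ` (`R_[Υ] = R`), `toModel_mem_RSub`, block weights of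
  `x̄_t` and `x_t`.
* §2 `wpBinomial_eq`, `varphi_wpBinomial`, `wpBinomial_mem_RSub`, `wpBinomial_isMultiHomogeneous`, **`Lem4_5_holds`**
  (all parameters; «This is trivial» — it is), `wpBinomials_subset_kerMH` (`B^℘_[k] ⊆ ker^{mh} φ_[k]`).
* §3 `varphi_monomial` (`φ(c x^e) = c x^{φ̂ e}`, `φ̂` written inline as a `Finsupp.sum`), **`C22L5_holds`**: every `f ∈ ker^{mh} φ_Φ` is a `k`-linear
  combination of monomial differences lying in `ker^{mh} φ_Φ` — for EVERY commutative ring `k` («regardless of the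
  characteristic»), by induction on the number of monomials (the fibre of `φ̂` through a monomial of `f` has coefficient
  sum `0` = the coefficient of `x^{φ̂ e₀}` in `φ f = 0`).
-/

noncomputable section

namespace Literature.AlgebraicGeometry.Hu2025.Statements.S04ModelV

open MvPolynomial

universe u v w x

variable {k : Type u} [CommRing k] {σ : Type v} {T : Type w} {𝔗 : Type x}

/-! ## §1 Toolkit on the carrier of `R103aModelR`: `φ`, `x̄_t`, `R_[k]`, block weights -/

/-- `x̄_t ∈ R_0 ⊂ R` is the monomial with exponent `monoR mono t`.
[cite: Hu2025, §4.1–4.2.1 Def. 4.3 / (4.7) / Lem. 4.5 (4.8), chunks p0021 l.107–140 / p0022 l.10–27, pp. 46–47 (unrefereed preprint arXiv:2507.21400v1 under adjudication, D-0012/D-0089 — kernel support on OUR typed carrier of row 103; nothing of the source asserted)] -/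
theorem toModel_img (mono : T → (σ →₀ ℕ)) (t : T) :
    (toModel (T := T) (img (k := k) mono t) : ModelRing σ T k) = monomial (monoR mono t) 1 := by
  unfold toModel img monoR
  rw [rename_monomial]

/-- `φ ∘ (R_0 ⊂ R) = id` («`φ_[k]|_{R_0} = Id_{R_0}`», (4.7)).
[cite: Hu2025, §4.1–4.2.1 Def. 4.3 / (4.7) / Lem. 4.5 (4.8), chunks p0021 l.107–140 / p0022 l.10–27, pp. 46–47 (unrefereed preprint arXiv:2507.21400v1 under adjudication, D-0012/D-0089 — kernel support on OUR typed carrier of row 103; nothing of the source asserted)] -/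
theorem varphi_toModel (mono : T → (σ →₀ ℕ)) (q : R0 σ k) :
    varphi (k := k) mono (toModel (T := T) q) = q := by
  unfold varphi toModel
  rw [aeval_rename]
  have h : (Sum.elim X (img (k := k) mono)) ∘ (Sum.inl : σ → σ ⊕ T) = X := by
    funext s; rfl
  rw [h]
  exact aeval_X_left_apply q

/-- `φ(x_t) = x̄_{u_s} x̄_{v_s}` («`x_(u_s,v_s) → x_{u_s} x_{v_s}`», (4.7)).
[cite: Hu2025, §4.1–4.2.1 Def. 4.3 / (4.7) / Lem. 4.5 (4.8), chunks p0021 l.107–140 / p0022 l.10–27, pp. 46–47 (unrefereed preprint arXiv:2507.21400v1 under adjudication, D-0012/D-0089 — kernel support on OUR typed carrier of row 103; nothing of the source asserted)] -/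
theorem varphi_rhoVar (mono : T → (σ →₀ ℕ)) (t : T) :
    varphi (k := k) mono (rhoVar (k := k) (σ := σ) t) = img mono t := by
  unfold varphi rhoVar
  rw [aeval_X]
  rfl

/-- `RSub rel univ = ⊤`: with all relations in play (`k = Υ`), `R_[Υ] = R`.
[cite: Hu2025, §4.1–4.2.1 Def. 4.3 / (4.7) / Lem. 4.5 (4.8), chunks p0021 l.107–140 / p0022 l.10–27, pp. 46–47 (unrefereed preprint arXiv:2507.21400v1 under adjudication, D-0012/D-0089 — kernel support on OUR typed carrier of row 103; nothing of the source asserted)] -/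
theorem RSub_univ (rel : T → 𝔗) : RSub (k := k) (σ := σ) rel (Set.univ : Set 𝔗) = ⊤ := by
  unfold RSub
  have h : (Set.range (Sum.inl : σ → σ ⊕ T) ∪ Sum.inr '' (rel ⁻¹' (Set.univ : Set 𝔗))) = Set.univ := by
    ext i
    constructor
    · intro _; trivial
    · intro _
      cases i with
      | inl s => exact Or.inl ⟨s, rfl⟩
      | inr t => exact Or.inr ⟨t, trivial, rfl⟩
  rw [h]
  exact supported_univ

/-- Anything coming from `R_0` lies in every `R_[k]`.
[cite: Hu2025, §4.1–4.2.1 Def. 4.3 / (4.7) / Lem. 4.5 (4.8), chunks p0021 l.107–140 / p0022 l.10–27, pp. 46–47 (unrefereed preprint arXiv:2507.21400v1 under adjudication, D-0012/D-0089 — kernel support on OUR typed carrier of row 103; nothing of the source asserted)] -/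
theorem toModel_mem_RSub [DecidableEq σ] [DecidableEq T] (rel : T → 𝔗) (Φ : Set 𝔗) (q : R0 σ k) :
    toModel (T := T) q ∈ RSub (k := k) (σ := σ) rel Φ := by
  unfold RSub toModel
  rw [mem_supported]
  intro i hi
  have hi' := vars_rename (Sum.inl : σ → σ ⊕ T) q hi
  rw [Finset.mem_image] at hi'
  obtain ⟨s, _, rfl⟩ := hi'
  exact Or.inl ⟨s, rfl⟩

/-- The block weight of an exponent vector supported on ϖ-variables is `0`.
[cite: Hu2025, §4.1–4.2.1 Def. 4.3 / (4.7) / Lem. 4.5 (4.8), chunks p0021 l.107–140 / p0022 l.10–27, pp. 46–47 (unrefereed preprint arXiv:2507.21400v1 under adjudication, D-0012/D-0089 — kernel support on OUR typed carrier of row 103; nothing of the source asserted)] -/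
theorem weight_blockWeight_monoR [DecidableEq 𝔗] (rel : T → 𝔗) (mono : T → (σ →₀ ℕ)) (G : 𝔗) (t : T) :
    Finsupp.weight (blockWeight rel G) (monoR mono t) = 0 := by
  classical
  rw [Finsupp.weight_apply, Finsupp.sum]
  apply Finset.sum_eq_zero
  intro i hi
  unfold monoR at hi
  obtain ⟨s, _, rfl⟩ := Finset.mem_image.mp (Finsupp.mapDomain_support hi)
  simp [blockWeight]

/-- The block weight of the ϱ-variable exponent `e_t`: `[rel t = G]`.
[cite: Hu2025, §4.1–4.2.1 Def. 4.3 / (4.7) / Lem. 4.5 (4.8), chunks p0021 l.107–140 / p0022 l.10–27, pp. 46–47 (unrefereed preprint arXiv:2507.21400v1 under adjudication, D-0012/D-0089 — kernel support on OUR typed carrier of row 103; nothing of the source asserted)] -/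
theorem weight_blockWeight_single [DecidableEq 𝔗] (rel : T → 𝔗) (G : 𝔗) (t : T) :
    Finsupp.weight (blockWeight rel G) (Finsupp.single (Sum.inr t : σ ⊕ T) 1) = if rel t = G then 1 else 0 := by
  rw [Finsupp.weight_single]
  unfold blockWeight
  simp

/-! ## §2 Lem. 4.5 / (4.8) AS TYPED: the ℘-binomial lies in `ker^{mh} φ_[k]` -/

/-- The ℘-binomial `x_{u′}x_{v′}x_(u,v) − x_u x_v x_(u′,v′)` as a difference of two monomials of `R`.
[cite: Hu2025, §4.1–4.2.1 Def. 4.3 / (4.7) / Lem. 4.5 (4.8), chunks p0021 l.107–140 / p0022 l.10–27, pp. 46–47 (unrefereed preprint arXiv:2507.21400v1 under adjudication, D-0012/D-0089 — kernel support on OUR typed carrier of row 103; nothing of the source asserted)] -/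
theorem wpBinomial_eq (mono : T → (σ →₀ ℕ)) (t t' : T) :
    (wpBinomial (k := k) mono t t' : ModelRing σ T k) =
      monomial (monoR mono t' + Finsupp.single (Sum.inr t) 1) 1 -
        monomial (monoR mono t + Finsupp.single (Sum.inr t') 1) 1 := by
  unfold wpBinomial rhoVar
  rw [toModel_img, toModel_img, X, X, monomial_mul, monomial_mul, one_mul]

/-- `φ` kills every ℘-binomial: `φ(x̄_{t′} x_t − x̄_t x_{t′}) = x̄_{t′} x̄_t − x̄_t x̄_{t′} = 0`.
[cite: Hu2025, §4.1–4.2.1 Def. 4.3 / (4.7) / Lem. 4.5 (4.8), chunks p0021 l.107–140 / p0022 l.10–27, pp. 46–47 (unrefereed preprint arXiv:2507.21400v1 under adjudication, D-0012/D-0089 — kernel support on OUR typed carrier of row 103; nothing of the source asserted)] -/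
theorem varphi_wpBinomial (mono : T → (σ →₀ ℕ)) (t t' : T) :
    varphi (k := k) mono (wpBinomial (k := k) (σ := σ) mono t t') = 0 := by
  unfold wpBinomial
  rw [map_sub, map_mul, map_mul, varphi_toModel, varphi_toModel, varphi_rhoVar, varphi_rhoVar, mul_comm, sub_self]

/-- A ℘-binomial of the block `F = rel t = rel t′` with `F ∈ Φ` lies in `R_Φ`.
[cite: Hu2025, §4.1–4.2.1 Def. 4.3 / (4.7) / Lem. 4.5 (4.8), chunks p0021 l.107–140 / p0022 l.10–27, pp. 46–47 (unrefereed preprint arXiv:2507.21400v1 under adjudication, D-0012/D-0089 — kernel support on OUR typed carrier of row 103; nothing of the source asserted)] -/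
theorem wpBinomial_mem_RSub [DecidableEq σ] [DecidableEq T] (rel : T → 𝔗) (mono : T → (σ →₀ ℕ)) (Φ : Set 𝔗)
    {t t' : T} (hrel : rel t = rel t') (hΦ : rel t ∈ Φ) :
    wpBinomial (k := k) (σ := σ) mono t t' ∈ RSub (k := k) rel Φ := by
  unfold wpBinomial
  have ht : rhoVar (k := k) (σ := σ) t ∈ RSub (k := k) rel Φ := by
    unfold rhoVar RSub
    rw [supported_eq_adjoin_X]
    exact Algebra.subset_adjoin ⟨Sum.inr t, Or.inr ⟨t, hΦ, rfl⟩, rfl⟩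
  have ht' : rhoVar (k := k) (σ := σ) t' ∈ RSub (k := k) rel Φ := by
    unfold rhoVar RSub
    rw [supported_eq_adjoin_X]
    refine Algebra.subset_adjoin ⟨Sum.inr t', Or.inr ⟨t', ?_, rfl⟩, rfl⟩
    rw [Set.mem_preimage, ← hrel]; exact hΦ
  exact Subalgebra.sub_mem _ (Subalgebra.mul_mem _ (toModel_mem_RSub rel Φ _) ht)
    (Subalgebra.mul_mem _ (toModel_mem_RSub rel Φ _) ht')

/-- A ℘-binomial of the block `F` is multi-homogeneous: block-`G` degree `[F = G]`.
[cite: Hu2025, §4.1–4.2.1 Def. 4.3 / (4.7) / Lem. 4.5 (4.8), chunks p0021 l.107–140 / p0022 l.10–27, pp. 46–47 (unrefereed preprint arXiv:2507.21400v1 under adjudication, D-0012/D-0089 — kernel support on OUR typed carrier of row 103; nothing of the source asserted)] -/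
theorem wpBinomial_isMultiHomogeneous [DecidableEq 𝔗] (rel : T → 𝔗) (mono : T → (σ →₀ ℕ)) {t t' : T}
    (hrel : rel t = rel t') : IsMultiHomogeneous (k := k) (σ := σ) rel (wpBinomial (k := k) mono t t') := by
  intro G
  refine ⟨if rel t = G then 1 else 0, ?_⟩
  rw [wpBinomial_eq, ← mem_weightedHomogeneousSubmodule]
  apply Submodule.sub_mem
  · rw [mem_weightedHomogeneousSubmodule]
    apply isWeightedHomogeneous_monomial
    rw [map_add, weight_blockWeight_monoR, weight_blockWeight_single, zero_add]
  · rw [mem_weightedHomogeneousSubmodule]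
    apply isWeightedHomogeneous_monomial
    rw [map_add, weight_blockWeight_monoR, weight_blockWeight_single, zero_add, ← hrel]

/-- **Hu 2025, Lem. 4.5 ‹chunk Lem. 4.4› / (4.8) — DISCHARGED AS TYPED** («Proof. This is trivial.»): for every
commutative ring `k`, all index data and every set `Φ` of relations in play, every ℘-binomial of a block in play lies in
`ker^{mh} φ_Φ` (the hypothesis `t ≠ t′` of the typed statement is not needed). Kernel fact about OUR rendering
`S04ModelV.Lem4_5`; the preprint stays under review.
[cite: Hu2025, §4.1–4.2.1 Def. 4.3 / (4.7) / Lem. 4.5 (4.8), chunks p0021 l.107–140 / p0022 l.10–27, pp. 46–47 (unrefereed preprint arXiv:2507.21400v1 under adjudication, D-0012/D-0089 — kernel support on OUR typed carrier of row 103; nothing of the source asserted)] -/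
theorem Lem4_5_holds : ∀ {k : Type u} [CommRing k] {σ : Type v} {T : Type w} {𝔗 : Type x} [DecidableEq 𝔗] [DecidableEq σ] [DecidableEq T]
    (rel : T → 𝔗) (mono : T → (σ →₀ ℕ)) (Φ : Set 𝔗), Lem4_5 (k := k) (σ := σ) rel mono Φ := by
  intro k _ σ T 𝔗 _ _ _ rel mono Φ t t' hrel _ hΦ
  exact ⟨wpBinomial_mem_RSub rel mono Φ hrel hΦ, wpBinomial_isMultiHomogeneous rel mono hrel,
    varphi_wpBinomial mono t t'⟩

/-- **Every member of `B^℘_[k]` (Def. 4.6) lies in `ker^{mh} φ_[k]`** (Lem. 4.5 applied to the set `wpBinomials`).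
[cite: Hu2025, §4.1–4.2.1 Def. 4.3 / (4.7) / Lem. 4.5 (4.8), chunks p0021 l.107–140 / p0022 l.10–27, pp. 46–47 (unrefereed preprint arXiv:2507.21400v1 under adjudication, D-0012/D-0089 — kernel support on OUR typed carrier of row 103; nothing of the source asserted)] -/
theorem wpBinomials_subset_kerMH [DecidableEq 𝔗] [DecidableEq σ] [DecidableEq T] (rel : T → 𝔗)
    (mono : T → (σ →₀ ℕ)) (Φ : Set 𝔗) :
    wpBinomials (k := k) (σ := σ) rel mono Φ ⊆ kerMH (k := k) rel mono Φ := by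
  rintro b ⟨t, t', hrel, hne, hΦ, rfl, _⟩
  exact Lem4_5_holds (k := k) rel mono Φ t t' hrel hne hΦ

/-! ## §3 `φ` is a monomial map; the claim C22L5 «it suffices to consider binomials» AS TYPED -/

/-- `φ` is a monomial map: `φ(c · x^e) = c · x^{φ̂ e}` with `φ̂ e = Σ_i e_i · (x_s ↦ e_s, x_t ↦ mono t)`.
[cite: Hu2025, §4.2 claim p0022 l.5–6 «it suffices to consider binomials», argument p0021 l.166–p0022 l.4, pp. 46–47 (unrefereed preprint arXiv:2507.21400v1 under adjudication, D-0012/D-0089 — kernel support on OUR typed carrier of row 103; nothing of the source asserted)] -/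
theorem varphi_monomial (mono : T → (σ →₀ ℕ)) (e : σ ⊕ T →₀ ℕ) (c : k) :
    varphi (k := k) mono (monomial e c) =
      monomial (e.sum fun i n => n • Sum.elim (fun s => Finsupp.single s 1) mono i) c := by
  unfold varphi
  rw [aeval_monomial, monomial_finsupp_sum_index, algebraMap_eq]
  congr 1
  unfold Finsupp.prod
  apply Finset.prod_congr rfl
  intro i _
  cases i with
  | inl s =>
    show X s ^ e (Sum.inl s) = _
    rw [X_pow_eq_monomial]
    congr 1
    simp
  | inr t =>
    show img (k := k) mono t ^ e (Sum.inr t) = _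
    unfold img
    rw [monomial_pow, one_pow]
    rfl

/-- A monomial occurring in a member of `R_Φ` lies in `R_Φ`.
[cite: Hu2025, §4.2 claim p0022 l.5–6 «it suffices to consider binomials», argument p0021 l.166–p0022 l.4, pp. 46–47 (unrefereed preprint arXiv:2507.21400v1 under adjudication, D-0012/D-0089 — kernel support on OUR typed carrier of row 103; nothing of the source asserted)] -/
theorem monomial_mem_RSub_of_mem_support [DecidableEq σ] [DecidableEq T] (rel : T → 𝔗) (Φ : Set 𝔗)
    {f : ModelRing σ T k} (hf : f ∈ RSub (k := k) rel Φ) {e : σ ⊕ T →₀ ℕ} (he : e ∈ f.support) (c : k) :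
    (monomial e c : ModelRing σ T k) ∈ RSub (k := k) rel Φ := by
  by_cases hc : c = 0
  · rw [hc, map_zero]; exact zero_mem _
  unfold RSub at hf ⊢
  rw [mem_supported] at hf ⊢
  rw [vars_monomial hc]
  intro i hi
  apply hf
  rw [Finset.mem_coe, mem_vars_iff_mem_support]
  exact ⟨e, he, hi⟩

/-- A monomial occurring in a multi-homogeneous `f` has `f`'s block weights.
[cite: Hu2025, §4.2 claim p0022 l.5–6 «it suffices to consider binomials», argument p0021 l.166–p0022 l.4, pp. 46–47 (unrefereed preprint arXiv:2507.21400v1 under adjudication, D-0012/D-0089 — kernel support on OUR typed carrier of row 103; nothing of the source asserted)] -/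
theorem weight_eq_of_mem_support [DecidableEq 𝔗] (rel : T → 𝔗) {f : ModelRing σ T k} {G : 𝔗} {d : ℕ}
    (hf : IsWeightedHomogeneous (blockWeight rel G) f d) {e : σ ⊕ T →₀ ℕ} (he : e ∈ f.support) :
    Finsupp.weight (blockWeight rel G) e = d :=
  hf (mem_support_iff.mp he)

/-- **Hu 2025, the in-text claim p0022 l.5–6 / PDF p.47 L014–L015 «regardless of the characteristic of the field 𝕜, it
suffices to consider binomials `m − m′ ∈ ker^{mh} φ_[k]`» — DISCHARGED AS TYPED (`C22L5`):** every element of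
`ker^{mh} φ_Φ` is a `k`-linear combination of differences of two monomials lying in `ker^{mh} φ_Φ`; for every
commutative ring `k` (in particular every characteristic), all index data and every `Φ`. The printed grouping argument,
formalised as an induction on the number of monomials: the fibre of `φ̂` through a monomial of `f` has coefficient sum
`0`, so subtracting `Σ c_e (x^e − x^{e₀})` over the fibre removes the fibre. Kernel fact about OUR rendering.
[cite: Hu2025, §4.2 claim p0022 l.5–6 «it suffices to consider binomials», argument p0021 l.166–p0022 l.4, pp. 46–47 (unrefereed preprint arXiv:2507.21400v1 under adjudication, D-0012/D-0089 — kernel support on OUR typed carrier of row 103; nothing of the source asserted)] -/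
theorem C22L5_holds : ∀ {k : Type u} [CommRing k] {σ : Type v} {T : Type w} {𝔗 : Type x} [DecidableEq 𝔗] [DecidableEq σ] [DecidableEq T]
    (rel : T → 𝔗) (mono : T → (σ →₀ ℕ)) (Φ : Set 𝔗), C22L5 (k := k) rel mono Φ := by
  intro k _ σ T 𝔗 _ _ _ rel mono Φ
  classical
  -- the span in question
  set V : Submodule k (ModelRing σ T k) := Submodule.span k {b : ModelRing σ T k |
    b ∈ kerMH (k := k) rel mono Φ ∧ ∃ a a' : σ ⊕ T →₀ ℕ, b = monomial a 1 - monomial a' 1} with hV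
  -- strong induction on the number of monomials
  suffices h : ∀ n : ℕ, ∀ f : ModelRing σ T k, f.support.card ≤ n → f ∈ kerMH (k := k) rel mono Φ → f ∈ V by
    intro f hf; exact h _ f le_rfl hf
  intro n
  induction n with
  | zero =>
    intro f hcard _
    have hf0 : f = 0 := by
      rw [← support_eq_empty, ← Finset.card_eq_zero]; omega
    rw [hf0]; exact zero_mem V
  | succ n ih =>
    intro f hcard hf
    by_cases hf0 : f = 0
    · rw [hf0]; exact zero_mem V
    obtain ⟨e₀, he₀⟩ := Finset.nonempty_of_ne_empty (mt support_eq_empty.mp hf0)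
    obtain ⟨hfR, hfH, hfφ⟩ := hf
    -- the fibre of `φ̂` through `e₀`
    set S := f.support.filter (fun e => (e.sum fun i n => n • Sum.elim (fun s => Finsupp.single s 1) mono i) =
      e₀.sum fun i n => n • Sum.elim (fun s => Finsupp.single s 1) mono i) with hS
    have he₀S : e₀ ∈ S := by rw [hS, Finset.mem_filter]; exact ⟨he₀, rfl⟩
    -- its coefficient sum vanishes: it is the coefficient of `x^{φ̂ e₀}` in `φ f = 0`
    have hsum : ∑ e ∈ S, coeff e f = 0 := by
      have h := congr_arg (coeff (e₀.sum fun i n => n • Sum.elim (fun s => Finsupp.single s 1) mono i)) hfφ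
      rw [coeff_zero, f.as_sum, map_sum, coeff_sum] at h
      simp_rw [varphi_monomial, coeff_monomial] at h
      rw [← Finset.sum_filter] at h
      rw [hS]
      exact h
    -- the correcting combination of binomials
    set g : ModelRing σ T k := ∑ e ∈ S, coeff e f • (monomial e 1 - monomial e₀ 1) with hg
    have hgV : g ∈ V := by
      apply Submodule.sum_mem
      intro e he
      apply Submodule.smul_mem
      apply Submodule.subset_span
      have he' : e ∈ f.support := (Finset.mem_filter.mp he).1
      refine ⟨⟨?_, ?_, ?_⟩, e, e₀, rfl⟩
      · exact Subalgebra.sub_mem _ (monomial_mem_RSub_of_mem_support rel Φ hfR he' 1)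
          (monomial_mem_RSub_of_mem_support rel Φ hfR he₀ 1)
      · intro G
        obtain ⟨d, hd⟩ := hfH G
        refine ⟨d, ?_⟩
        rw [← mem_weightedHomogeneousSubmodule]
        apply Submodule.sub_mem <;> rw [mem_weightedHomogeneousSubmodule] <;>
          apply isWeightedHomogeneous_monomial
        · exact weight_eq_of_mem_support rel hd he'
        · exact weight_eq_of_mem_support rel hd he₀
      · rw [map_sub, varphi_monomial, varphi_monomial, (Finset.mem_filter.mp he).2, sub_self]
    -- `g` is the fibre part of `f` (the `x^{e₀}` terms cancel because the fibre's coefficient sum is `0`)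
    have hg' : g = ∑ e ∈ S, monomial e (coeff e f) := by
      rw [hg]
      simp_rw [smul_sub]
      rw [Finset.sum_sub_distrib, ← Finset.sum_smul, hsum, zero_smul, sub_zero]
      apply Finset.sum_congr rfl
      intro e _
      rw [smul_monomial, smul_eq_mul, mul_one]
    -- `f - g` is `f` with the fibre removed
    have hSsub : S ⊆ f.support := by rw [hS]; exact Finset.filter_subset _ _
    have hsplit : f = ∑ e ∈ f.support \ S, monomial e (coeff e f) + ∑ e ∈ S, monomial e (coeff e f) := by
      conv_lhs => rw [f.as_sum]
      rw [Finset.sum_sdiff hSsub]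
    have hfg : f - g = ∑ e ∈ f.support \ S, monomial e (coeff e f) := by
      rw [hg', sub_eq_iff_eq_add]
      exact hsplit
    have hsupp : (f - g).support ⊆ f.support \ S := by
      rw [hfg]
      intro e he
      have := support_sum he
      rw [Finset.mem_biUnion] at this
      obtain ⟨e', he', hee'⟩ := this
      have := support_monomial_subset hee'
      rw [Finset.mem_singleton] at this
      rwa [this]
    have hcard' : (f - g).support.card ≤ n := by
      have h1 : (f.support \ S).card < f.support.card := by
        apply Finset.card_lt_card
        rw [Finset.ssubset_iff_of_subset Finset.sdiff_subset]
        exact ⟨e₀, he₀, fun h => (Finset.mem_sdiff.mp h).2 he₀S⟩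
      have h2 := Finset.card_le_card hsupp
      omega
    -- `f - g ∈ ker^{mh}`
    have hfg_mem : f - g ∈ kerMH (k := k) rel mono Φ := by
      refine ⟨?_, ?_, ?_⟩
      · rw [hfg]
        exact Subalgebra.sum_mem _ fun e he =>
          monomial_mem_RSub_of_mem_support rel Φ hfR (Finset.mem_sdiff.mp he).1 _
      · intro G
        obtain ⟨d, hd⟩ := hfH G
        refine ⟨d, ?_⟩
        rw [hfg, ← mem_weightedHomogeneousSubmodule]
        apply Submodule.sum_mem
        intro e he
        rw [mem_weightedHomogeneousSubmodule]
        exact isWeightedHomogeneous_monomial _ _ _ (weight_eq_of_mem_support rel hd (Finset.mem_sdiff.mp he).1)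
      · rw [map_sub, hfφ, zero_sub, neg_eq_zero, hg, map_sum]
        apply Finset.sum_eq_zero
        intro e he
        rw [map_smul, map_sub, varphi_monomial, varphi_monomial, (Finset.mem_filter.mp he).2, sub_self,
          smul_zero]
    have := ih (f - g) hcard' hfg_mem
    have hf_eq : f = (f - g) + g := (sub_add_cancel f g).symm
    rw [hf_eq]
    exact V.add_mem this hgV

end Literature.AlgebraicGeometry.Hu2025.Statements.S04ModelV

end
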